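import Summits.CriticalPhenomena.PercolationContinuityZ3.Theorems.PercNearOneGluingNoHeavyQuantGateSliceDominated
import Summits.CriticalPhenomena.PercolationContinuityZ3.Theorems.PercNearOneGluingNoHeavyQuantSpineSDEC
import Summits.CriticalPhenomena.PercolationContinuityZ3.Theorems.PercNearOneGluingNoHeavyQuantSDECBlobs
import HarnessLib

/-!
# QUANT lane R8, T-DEC: HAIRY CATERPILLARS WITH DOMINANT GLUED HAIRS ARE SDEC — the reached-relay count of every spine of gates carrying
# sure relays AND glued classes ("blobs") of relays whose gate dominates the count law below their attachment vertex is gate-stable DEC,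
# hence DEC at every layer and FAR at every dominant layer, UNCONDITIONALLY (typer g26's spine family + the lead's dominated gated slice)

builds on p205010 (kernel theorem, internal audit signed; external expert review pending)

Support file (`--supports stmt-CriticalPhenomena-4575`), QUANT lane lead (gen 27), rung R8 of `run/shared/lean/prim/quant/LADDER.md`; memo
`run/shared/lean/prim/quant/prim-quant-lead-g27/LEAD-NOTES-G27.md` N76–N77.  One inductive predicate, theorems with standard axioms, no sorries.
Continues typer g26's `…QuantSpineSDEC` (`SpineBuilt`, Conjecture R iterated) with one more building step, the lead's `…QuantGateSliceDominated`
(`sdec_slice_of_dominated`: SDEC is closed under hanging a heavy blob `{0,a;g}` beside a law `μ` with `μ 0 ≥ 1 − g`).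

THE FAMILY.  `LawDec.BlobSpineBuilt x M μ`: from `δ₀` by (i) `k` sure relays at the root under a new gate `q` (`μ ↦ gate_q(μ(· − k))`, floor `↦ qx`),
(ii) a DOMINATED HEAVY BLOB BESIDE (`μ ↦ slice μ a g = {0,a;g} ∗ μ` with `x ≤ g ≤ 1`, `a ≥ 1`, `1 − g ≤ μ 0`), (iii) floor lowering.  In tree language:
caterpillars (a spine of gates, each vertex carrying any number of sure relays) decorated with glued hairs — a class of `a` relays hung from a spine
vertex by one gate `g` — such that each hair's gate is at least the gate-defect of the law accumulated so far at its vertex (for a hair attached beside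
the continuation of the spine through a gate `q'`: `g ≥ q'` suffices), at any floor at most the least marginal.  Every such law is a top-affordable
probability law, SDEC at its floor (`blobSpineBuilt_sdec`), hence DEC(j′) at EVERY layer (`decAt_of_blobSpineBuilt`, the conclusion of `Quant.TreeDEC`
for this family) and satisfies the FAR tree row at every dominant layer (`blobSpine_tail_ge`); and it is tree-built (`treeBuilt_of_blobSpineBuilt`), so this
is an unconditional sub-family of `TreeBuiltDEC`.  HONEST STATUS: hairs that do NOT dominate (`g < 1 − μ 0`), branch points of degree ≥ 3 and general
`TreeBuiltDEC` / `TreeDEC` / `FarTreeRow` remain OPEN (README V293/V294).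

[this work]; `SpineBuilt` / Conjecture R: typer g25–g26; slice theorem: typer g24; SDEC: census-2 g53 (this lane).  Nothing here is cited as a published
result.  The gluing rows served [cite: KozmaNitzan2024, Conjecture 3 (p. 15)]; product measure [cite: Grimmett1999, §1.3 p. 10].
-/

noncomputable section

namespace Summit.CriticalPhenomena.PercolationContinuityZ3.Theorems

namespace Quant

open Finset

namespace LawDec

/-! ### Blob-spine laws -/

/-- **Blob-spine-built count laws** (hairy caterpillars with dominant glued hairs): from `δ₀` by "add `k` sure relays at the root and hang under a
gate `0 < q ≤ 1`" (`μ ↦ gate (μ(· − k)) q`, floor `↦ q·x`), "hang a dominated heavy blob beside" (`μ ↦ slice μ a g`, `x ≤ g ≤ 1`, `1 ≤ a`,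
`1 − g ≤ μ 0`), and floor lowering. [this work] -/
inductive BlobSpineBuilt : ℝ → ℕ → (ℕ → ℝ) → Prop
  | nil (x : ℝ) (hx0 : 0 < x) (hx1 : x < 1) : BlobSpineBuilt x 0 (fun h => if h = 0 then (1 : ℝ) else 0)
  | hang {x : ℝ} {M : ℕ} {μ : ℕ → ℝ} (k : ℕ) (q : ℝ) (hq0 : 0 < q) (hq1 : q ≤ 1) (h : BlobSpineBuilt x M μ) :
      BlobSpineBuilt (q * x) (k + M) (gate (fun t => if k ≤ t then μ (t - k) else 0) q)
  | blob {x : ℝ} {M : ℕ} {μ : ℕ → ℝ} (a : ℕ) (g : ℝ) (hxg : x ≤ g) (hg1 : g ≤ 1) (ha : 1 ≤ a) (hdom : 1 - g ≤ μ 0)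
      (h : BlobSpineBuilt x M μ) : BlobSpineBuilt x (M + a) (slice μ a g)
  | mono {x x' : ℝ} {M : ℕ} {μ : ℕ → ℝ} (h : BlobSpineBuilt x M μ) (hx'0 : 0 < x') (hxx : x' ≤ x) : BlobSpineBuilt x' M μ

/-- spine laws are blob-spine laws. [this work] -/
theorem blobSpineBuilt_of_spineBuilt {x : ℝ} {M : ℕ} {μ : ℕ → ℝ} (h : SpineBuilt x M μ) : BlobSpineBuilt x M μ := by
  induction h with
  | nil x₀ hx0 hx1 => exact BlobSpineBuilt.nil x₀ hx0 hx1
  | @hang x₀ M₀ μ₀ k q hq0 hq1 _ ih => exact BlobSpineBuilt.hang k q hq0 hq1 ih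
  | @mono x₀ x' M₀ μ₀ _ hx'0 hxx ih => exact BlobSpineBuilt.mono ih hx'0 hxx

/-- **BLOB-SPINE LAWS ARE SDEC.**  Every blob-spine law is a probability law on `{0..M}` at a floor in `(0,1)`, top-affordable, and SDEC there
(relay step: Conjecture R `gatedShift_sdecUpTo` + `sdec_gate`; blob step: `sdec_slice_of_dominated`; floor: `sdec_mono`). [this work] -/
theorem blobSpineBuilt_sdec {x : ℝ} {M : ℕ} {μ : ℕ → ℝ} (h : BlobSpineBuilt x M μ) :
    0 < x ∧ x < 1 ∧ (∀ t, 0 ≤ μ t) ∧ (∀ t, M < t → μ t = 0) ∧ (∑ t ∈ Finset.range (M + 1), μ t = 1) ∧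
      x * (M : ℝ) ≤ (∑ t ∈ Finset.range (M + 1), (t : ℝ) * μ t) ∧ SDEC x M μ := by
  induction h with
  | nil x₀ hx0 hx1 =>
    refine ⟨hx0, hx1, fun t => ?_, fun t ht => if_neg (by omega), by simp, by simp, ?_⟩
    · beta_reduce; split_ifs <;> norm_num
    · intro q _ _ j' hj; omega
  | @hang x₀ M₀ μ₀ k q hq0 hq1 h ih =>
    obtain ⟨hx0, hx1, n0, zM, s1, ta, sd⟩ := ih
    obtain ⟨sh0, shM, sh1, shmean⟩ := shift_laws k M₀ μ₀ n0 zM s1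
    have shS : SDEC x₀ (k + M₀) (fun t => if k ≤ t then μ₀ (t - k) else 0) := by
      rcases Nat.eq_zero_or_pos k with hk | hk
      · subst hk
        have e : (fun t => if 0 ≤ t then μ₀ (t - 0) else 0) = μ₀ := funext fun t => by simp
        rw [e, Nat.zero_add]; exact sd
      · have := gatedShift_sdecUpTo x₀ 1 k M₀ μ₀ hx0 hx1.le le_rfl (by linarith) hk n0 zM s1 ta
          ((sdecUpTo_one_iff x₀ M₀ μ₀).2 sd)
        exact (sdecUpTo_one_iff x₀ (k + M₀) _).1 this
    obtain ⟨g0, gM, g1⟩ := gate_laws (k + M₀) _ q hq0.le hq1 sh0 shM sh1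
    refine ⟨mul_pos hq0 hx0, by nlinarith, g0, gM, g1, ?_, sdec_gate shS q hq0 hq1⟩
    rw [sum_mul_gate, shmean]
    have h1 : x₀ * ((k + M₀ : ℕ) : ℝ) ≤ (∑ t ∈ Finset.range (M₀ + 1), (t : ℝ) * μ₀ t) + k := by
      push_cast
      have : x₀ * (k : ℝ) ≤ k := by nlinarith [(Nat.cast_nonneg k : (0 : ℝ) ≤ k)]
      linarith
    have h2 : q * x₀ * ((k + M₀ : ℕ) : ℝ) ≤ q * ((∑ t ∈ Finset.range (M₀ + 1), (t : ℝ) * μ₀ t) + k) := by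
      have := mul_le_mul_of_nonneg_left h1 hq0.le
      linarith [this]
    exact h2
  | @blob x₀ M₀ μ₀ a g hxg hg1 ha hdom h ih =>
    obtain ⟨hx0, hx1, n0, zM, s1, ta, sd⟩ := ih
    have hg0 : 0 < g := lt_of_lt_of_le hx0 hxg
    refine ⟨hx0, hx1, fun t => slice_nonneg μ₀ a g hg0.le hg1 n0 t, fun t ht => slice_eq_zero μ₀ a g M₀ zM t ht,
      sum_slice μ₀ a g M₀ zM s1, ?_, sdec_slice_of_dominated x₀ g a M₀ μ₀ hx0 hx1 hxg hg1 ha n0 zM s1 ta hdom sd⟩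
    rw [sum_mul_slice μ₀ a g M₀ zM s1]
    push_cast
    nlinarith [(Nat.cast_nonneg a : (0 : ℝ) ≤ a)]
  | @mono x₀ x' M₀ μ₀ h hx'0 hxx ih =>
    obtain ⟨hx0, hx1, n0, zM, s1, ta, sd⟩ := ih
    refine ⟨hx'0, lt_of_le_of_lt hxx hx1, n0, zM, s1, ?_, sdec_mono sd hxx hx1⟩
    have : x' * (M₀ : ℝ) ≤ x₀ * (M₀ : ℝ) := mul_le_mul_of_nonneg_right hxx (Nat.cast_nonneg _)
    linarith

/-- **every blob-spine law is DEC(j′) at EVERY layer** — the conclusion of `Quant.TreeDEC` for hairy caterpillars with dominant glued hairs,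
unconditionally. [this work] -/
theorem decAt_of_blobSpineBuilt {x : ℝ} {M : ℕ} {μ : ℕ → ℝ} (h : BlobSpineBuilt x M μ) (j' : ℕ) : DECAt x j' M μ := by
  obtain ⟨hx0, hx1, n0, zM, s1, ta, sd⟩ := blobSpineBuilt_sdec h
  exact decAt_of_sdec sd hx0 hx1 n0 zM s1 ta j'

/-- **the FAR tree row for blob-spines**: at every dominant layer (`2j′ <` mean), `x ≤ P(N ≥ j′ + 1)`. [this work] -/
theorem blobSpine_tail_ge {x : ℝ} {M : ℕ} {μ : ℕ → ℝ} (h : BlobSpineBuilt x M μ) (j' : ℕ)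
    (hdom : (2 * j' : ℝ) < ∑ t ∈ Finset.range (M + 1), (t : ℝ) * μ t) :
    x ≤ ∑ t ∈ Finset.Ico (j' + 1) (M + 1), μ t := by
  obtain ⟨_, hx1, _, _, _, _, _⟩ := blobSpineBuilt_sdec h
  exact tail_ge_of_decAt x j' M μ hx1.le (decAt_of_blobSpineBuilt h j') hdom

/-- the sure block `δ_k` is tree-built at every floor in `(0,1)` (a spine with one gate `1`). [this work] -/
theorem treeBuilt_block (x : ℝ) (hx0 : 0 < x) (hx1 : x < 1) (k : ℕ) : TreeBuilt x k (fun i => if i = k then (1 : ℝ) else 0) := by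
  have hk : SpineBuilt (1 * x) (k + 0) (gate (fun t => if k ≤ t then (fun h : ℕ => if h = 0 then (1 : ℝ) else 0) (t - k) else 0) 1) :=
    SpineBuilt.hang k 1 one_pos le_rfl (SpineBuilt.nil x hx0 hx1)
  have e2 : gate (fun t => if k ≤ t then (fun h : ℕ => if h = 0 then (1 : ℝ) else 0) (t - k) else 0) 1
      = fun i => if i = k then (1 : ℝ) else 0 := by
    rw [gate_one]
    funext t
    beta_reduce
    by_cases ht : t = k
    · subst ht; simp
    · by_cases hkt : k ≤ t
      · rw [if_pos hkt, if_neg (by omega), if_neg ht]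
      · rw [if_neg hkt, if_neg ht]
  rw [e2, Nat.add_zero, one_mul] at hk
  exact treeBuilt_of_spineBuilt hk

/-- the heavy blob `{0, a; g} = gate_g δ_a` is tree-built at every floor `x' < g` (`0 < x'`, `g ≤ 1`). [this work] -/
theorem treeBuilt_blob (x' g : ℝ) (a : ℕ) (hx0 : 0 < x') (hxg : x' < g) (hg1 : g ≤ 1) :
    TreeBuilt x' a (gate (fun i => if i = a then (1 : ℝ) else 0) g) := by
  have hg0 : 0 < g := hx0.trans hxg
  have hb := TreeBuilt.gate g hg0 hg1 (treeBuilt_block (x' / g) (div_pos hx0 hg0) (by rw [div_lt_one hg0]; exact hxg) a)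
  rwa [mul_div_cancel₀ _ (ne_of_gt hg0)] at hb

/-- blob-spine laws are tree-built at every strictly lower floor (a blob beside is the convolution with the gate `g` of the sure block `δ_a`;
the floors of `TreeBuilt` scale with the gates, so the lone blob is tree-built at every floor `< g`), hence `blobSpineBuilt_sdec` is an
unconditional sub-family of `TreeBuiltDEC` up to floor lowering. [this work] -/
theorem treeBuilt_of_blobSpineBuilt {x : ℝ} {M : ℕ} {μ : ℕ → ℝ} (h : BlobSpineBuilt x M μ) :
    ∀ x', 0 < x' → x' < x → TreeBuilt x' M μ := by
  induction h with
  | nil x₀ hx0 hx1 => exact fun x' h0 h1 => TreeBuilt.nil x' h0 (h1.trans hx1)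
  | @hang x₀ M₀ μ₀ k q hq0 hq1 h ih =>
    intro x' h0 h1
    obtain ⟨hx0, hx1, _, zM, _, _, _⟩ := blobSpineBuilt_sdec h
    have h1' : x' / q < x₀ := by rw [div_lt_iff₀ hq0]; linarith
    have e : (fun t => if k ≤ t then μ₀ (t - k) else 0) = lconv k M₀ (fun i => if i = k then (1 : ℝ) else 0) μ₀ :=
      (funext fun t => lconv_point_left k M₀ μ₀ zM t).symm
    rw [e]
    have hb := TreeBuilt.gate q hq0 hq1
      (TreeBuilt.conv (treeBuilt_block (x' / q) (div_pos h0 hq0) (h1'.trans hx1) k) (ih (x' / q) (div_pos h0 hq0) h1'))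
    rwa [mul_div_cancel₀ _ (ne_of_gt hq0)] at hb
  | @blob x₀ M₀ μ₀ a g hxg hg1 ha hdom h ih =>
    intro x' h0 h1
    obtain ⟨_, _, _, zM, _, _, _⟩ := blobSpineBuilt_sdec h
    rw [← lconv_gate_point_eq_slice M₀ a μ₀ g zM]
    exact TreeBuilt.conv (ih x' h0 h1) (treeBuilt_blob x' g a h0 (lt_of_lt_of_le h1 hxg) hg1)
  | @mono x₀ x'' M₀ μ₀ h hx'0 hxx ih => exact fun x' h0 h1 => ih x' h0 (lt_of_lt_of_le h1 hxx)

end LawDec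

end Quant

end Summit.CriticalPhenomena.PercolationContinuityZ3.Theorems
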